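import Literature.Topology.FourManifolds.LefschetzHandlebody
import Summits.SmoothPoincare4.SmoothPoincare4.Theorems.ConvexBisectionAcyclicBisectionExistsMultiAttachmentSplit
import HarnessLib

/-!
# Splitting a simultaneous attachment of handles, III: the Lefschetz link of a sorted word,
# `X(F; P ++ N) = (Base g ∪ positive handles) ∪ negative handles`
(helper file 3/3 of the NF6 brick for stub `stub_steinRealisation`, line `modp-braid-orbits` r11,
crux `ConvexBisection.AcyclicBisectionExists`, item stmt-SmoothPoincare4-10508; wave 1, lead c4)

Sequel of `…MultiAttachmentSplitData.lean` and `…MultiAttachmentSplit.lean` (general prefix /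
suffix splitting `exists_split_of_sumElim_eq`, `isMultiAttachment_lift_iff_of_equiv`).  Towards
the topological half of Baykur's Stein realisation
(`Literature.Geometry.Symplectic.steinRealisation_of_sorted_modelsOnFibred`, NF6; Baykur 2006,
proof of Thm. 5.1: the sorted fibred model `X(F; P ++ N) ∪ Base g` is `W₁ ∪ W₂` with
`W₁ = X(F; P)` the positive Lefschetz handlebody): for attaching maps
`h̄ : Fin |P ++ N| → HandleAttachingMap 3 2 (Base g)` — e.g. a Lefschetz link realising `P ++ N`
(`IsLefschetzLink`) — and `X = Base g ∪_{h̄} (handles)`, the registered helper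
`helper_isMultiAttachment_split_append` produces the compact Hausdorff second-countable
`X₁ = Base g ∪ (h̄ᵢ)_{i < |P|}` (indices `Fin.cast _ (Fin.castAdd |N| i)` as in
`IsLefschetzLink.prefix` of `…SteinRealisationTopologicalEnds.lean`) with data `D₁`, such that
`X` is `X₁` with the last `|N|` handles attached along the lifted maps, and characterises such
attachments (`sumElim_cast_castAdd_natAdd` realises the two index embeddings by
`finSumFinEquiv.trans (finCongr _) : Fin |P| ⊕ Fin |N| ≃ Fin |P ++ N|`).

What this does NOT yet give towards `IsLefschetzHandlebody g P X₁`: the prefix sub-link keeps its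
shadows and page twistings but its circles lie in the pages `pageDir (|P| + |N|) i`, not
`pageDir |P| i` (`IsLefschetzLink.prefix`); a page-rotating diffeomorphism of `Base g` is still
needed (recorded in the report of the stub).  Everything here is proved; no named facts.

## References
* A. A. Kosinski, *Differential Manifolds*, Academic Press (1993), VI §6, (7.1), VII proof of
  (1.2). [Kosinski1993]
* R. İ. Baykur, *Kähler decomposition of 4-manifolds*, AGT 6 (2006), proof of Thm. 5.1.
  [Baykur2006]
-/

noncomputable section

-- the prescribed namespace `Summit.<P>.<Sub>.…` duplicates `SmoothPoincare4` (P = Sub)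
set_option linter.dupNamespace false

open scoped Manifold ContDiff Topology

namespace Summit.SmoothPoincare4.SmoothPoincare4.Theorems.AcyclicBisectionExists.ModpBraidOrbits

open Set Function
open Literature.Topology.FourManifolds Literature.Topology.FourManifolds.HandleAttachingMap
  Literature.Topology.FourManifolds.LefschetzBase

universe u

/-- `Fin |P| ⊕ Fin |N| ≃ Fin |P ++ N|` realises the prefix/suffix indices
`Fin.cast _ (Fin.castAdd |N| i)`, `Fin.cast _ (Fin.natAdd |P| j)` of `IsLefschetzLink.prefix/suffix`.
[folklore] -/
theorem sumElim_cast_castAdd_natAdd {α β : Type*} (P N : List β) (h : Fin (P ++ N).length → α)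
    (x : Fin P.length ⊕ Fin N.length) :
    Sum.elim (fun i => h (Fin.cast List.length_append.symm (Fin.castAdd N.length i)))
        (fun j => h (Fin.cast List.length_append.symm (Fin.natAdd P.length j))) x =
      h ((finSumFinEquiv.trans (finCongr List.length_append.symm)) x) := by
  cases x <;> simp

/-- **Registered helper `helper_isMultiAttachment_split_append` (sub-goal of NF6 `stub_steinRealisation`, wave 1,
lead c4): `X(F; P ++ N) = (Base g ∪ positive handles) ∪ negative handles`.**  For attaching maps
`h̄ : Fin |P ++ N| → HandleAttachingMap 3 2 (Base g)` (e.g. a Lefschetz link realising the sorted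
word `P ++ N`) and `X = Base g ∪_{h̄} (handles)` (e.g. the piece of a fibred model
`ModelsOnFibred M g (P ++ N)`): there is a compact Hausdorff second-countable `C^∞` 4-manifold with
boundary `X₁ = Base g ∪ (h̄ᵢ)_{i < |P|}` — Baykur's `X₊` as a bare manifold, indices
`Fin.cast _ (Fin.castAdd |N| i)` as in `IsLefschetzLink.prefix` — with data `D₁`, such that `X` is
`X₁` with the last `|N|` handles attached along the lifted maps, and a manifold is such an
attachment iff it is `Base g ∪_{h̄} (handles)`.  (Towards `IsLefschetzHandlebody g P X₁` a page
rotation of `Base g` is still needed: the prefix circles lie in the pages `pageDir (|P|+|N|) i`.)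
[cite: Baykur2006, Thm. 5.1 (proof, pp. 13–14)] -/
theorem helper_isMultiAttachment_split_append :
    ∀ (g : ℕ) (P N : List ((Fin g ⊕ Fin g → ℤ) × Bool))
      (h : Fin (P ++ N).length → HandleAttachingMap 3 2 (Base g)) (X : Type) [TopologicalSpace X]
      [ChartedSpace (EuclideanHalfSpace 4) X] [IsManifold (𝓡∂ 4) ∞ X],
      HandleAttachingMap.IsMultiAttachment h (𝓡∂ 4) X →
      ∃ (X₁ : Type) (_ : TopologicalSpace X₁) (_ : T2Space X₁) (_ : SecondCountableTopology X₁)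
        (_ : CompactSpace X₁) (_ : ChartedSpace (EuclideanHalfSpace 4) X₁) (_ : IsManifold (𝓡∂ 4) ∞ X₁)
        (D₁ : HandleAttachingMap.MultiAttachmentData
          (fun i : Fin P.length => h (Fin.cast List.length_append.symm (Fin.castAdd N.length i)))
          (𝓡∂ 4) X₁)
        (hd : ∀ (j : Fin N.length) (i : Fin P.length),
          Disjoint (Set.range (h (Fin.cast List.length_append.symm (Fin.natAdd P.length j))).toFun)
            (Set.range (h (Fin.cast List.length_append.symm (Fin.castAdd N.length i))).toFun)),
        HandleAttachingMap.IsMultiAttachment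
          (fun j : Fin N.length =>
            D₁.lift (h (Fin.cast List.length_append.symm (Fin.natAdd P.length j))) (hd j)) (𝓡∂ 4) X ∧
        ∀ (X₂ : Type) [TopologicalSpace X₂] [ChartedSpace (EuclideanHalfSpace 4) X₂]
          [IsManifold (𝓡∂ 4) ∞ X₂],
          HandleAttachingMap.IsMultiAttachment
              (fun j : Fin N.length =>
                D₁.lift (h (Fin.cast List.length_append.symm (Fin.natAdd P.length j))) (hd j))
              (𝓡∂ 4) X₂ ↔
            HandleAttachingMap.IsMultiAttachment h (𝓡∂ 4) X₂ := by
  intro g P N h X _ _ _ hX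
  obtain ⟨X₁, _, _, _, _, _, D₁, hd, hcpt, hX'⟩ :=
    exists_split_of_sumElim_eq h _ (sumElim_cast_castAdd_natAdd P N h) hX
  exact ⟨X₁, _, inferInstance, inferInstance, hcpt inferInstance, _, _, D₁, hd, hX', fun X₂ _ _ _ =>
    isMultiAttachment_lift_iff_of_equiv h _ (sumElim_cast_castAdd_natAdd P N h) D₁ hd⟩

end Summit.SmoothPoincare4.SmoothPoincare4.Theorems.AcyclicBisectionExists.ModpBraidOrbits

end
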